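import Summits.Ventures.CertifiedArithmetic.LowPrec.SRPythagorasExchange
import Summits.Ventures.CertifiedArithmetic.LowPrec.SRTreeLimitedBits
import HarnessLib

/-!
# Stochastic rounding in low-precision formats CXVII — the Pythagorean law LEVEL BY LEVEL:
# the exact time-local decomposition `E(ŝₙ − sₙ)² = Σₖ E[eₖ² − 2·Rₖ·yₖ]`, the level-budget
# certificate, and the law for every tree with a DETERMINISTIC truncation schedule (any value set,
# any rounding-probability rule, any number of random bits)

HONEST FRAMING: certified error envelopes and provably optimal rounding/accumulation schemes for
low-precision formats under stated cost models; every table by two implementations; no hardware or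
vendor claims.

All decompositions of the mean-square error of a limited-randomness accumulation used so far in this
slice are BACKWARD (condition on the first rounding: XC `accExpQ_sq_eq_noiseQ_add_bias2Q`, the node
budgets of CIV/CXV, the pair-deficit exchange of CXIV).  This file records the FORWARD (time-local)
bookkeeping.  Write `ŝ_{k+1} = ŝ_k + x_k + e_k`, `c_k = ŝ_k + x_k`, `y_k = y(c_k) = c_k − E[round c_k]`
(the mean truncation of step `k`, `truncQ`), `R_k = ŝ_k − s_k` (the running error).  Then, for EVERY
finite value set `F`, every probability rule `q` and every data (`acc_sq_succ_level`,
`acc_sq_eq_sum_levelQ`):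
  `E(ŝₙ − sₙ)² = Σ_{k<n} L_k`,  `L_k = E[ E(e_k² | ŝ_k) − 2·R_k·y_k ]`  (`levelQ`),
an identity with no hypotheses (two-point steps are affine in the integrand).  Consequences:
* `acc_sq_le_of_levelLE` — the LEVEL-BUDGET CERTIFICATE: if `L_k ≤ G²/4 + (2k+1)(εG)²` for every
  `k < n` (`LevelLE`, decidable per tree: `levelLEB_iff`), then `E(ŝₙ − sₙ)² ≤ n·G²/4 + (n·εG)²`.
  Kernel instance (`e3m2_xNB3_levelLE_law`): the E3M2 tree of CXV's docstring that breaks every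
  3-bit NODE budget (`[3/8, 28]`, `N = 3`, six summands of both signs) satisfies the LEVEL budget at all
  six levels, which certifies its law `E(ŝ₆ − s₆)² ≤ 33` (exact value `5812069/524288`).
* `acc_sq_le_of_truncSched` — **DETERMINISTIC TRUNCATION ⇒ PYTHAGOREAN LAW**, for ANY `F`, ANY rule
  `q : [0,1] → [0,1]` and any data: if along every branch the mean truncation of step `k` is the same
  number `η_k` (`TruncSched η`; e.g. every tree living on an equally spaced window, every exactly
  representable step, the extremal family `x_k ≡ G/2 + E − δ` of CXV's tightness discussion), then
  `E[ŝₙ] = sₙ − Σ η_k` exactly and `E(ŝₙ − sₙ)² ≤ n·G²/4 + (Σ_{k<n} η_k)²`; with `|q(θ) − θ| ≤ ε`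
  this is `≤ n·G²/4 + (n·εG)²` (`acc_sq_le_of_truncSched_eps`), and for IEEE P3109 StochasticA with
  `N` random bits `≤ n·G²/4 + (n·2^{-N}·G)²` for EVERY `N` and every window depth
  (`stochasticA_acc_sq_le_of_truncSched`).  So the entire difficulty of the open `3 ≤ N < J` question
  of CXV is DIFFERENTIAL truncation across branches (states of one level in cells of different widths,
  or misaligned modulo the sub-quantum); the level term prices it as `−2·Cov(R_k, y_k)`.
Scope (honest): the identity and both criteria are elementary; `LevelLE` is a sufficient condition
checked per tree, not a theorem about all trees (no violating StochasticA tree on a one-signed nested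
window is known to us, none was found in this generation's exact searches, and none is claimed
impossible); nothing here decides CXV's open question.  Exact expectations over the outcome tree; no
saturation where stated.
Prior art: the martingale/forward view of stochastic-rounding errors is standard
([ConnollyHighamMary2021, Lemma 4.4, Thm. 4.6]; [ElararEtAl2025, Thm. 2–4], mean-independent
martingale part plus bias); the per-tree level certificate and the deterministic-truncation law in this
exact combinatorial model are ours.  No Mathlib precedent.
-/

namespace Summit.Ventures.CertifiedArithmetic.LowPrec.SR

open Literature.ComputerArithmetic.ConnollyHighamMary2021
open Finset

variable {K : Type*} [Field K] [LinearOrder K] [IsStrictOrderedRing K] [FloorRing K]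

namespace LimitedBits

/-! ### 1. One-step truncation, one-step mean-square error, the level term -/

/-- Mean TRUNCATION of one perturbed-SR step at the pre-rounding value `c`: `y(c) = c − E[round c]`. -/
def truncQ (F : Finset K) (q : K → K) (c : K) : K := c - stepQ F q c (fun z => z)

/-- One-step mean-square error `E(round c − c)²` (`= π(1−π)w² + y(c)²`, `sqStepQ_eq`). -/
def sqStepQ (F : Finset K) (q : K → K) (c : K) : K := stepQ F q c (fun z => (z - c) ^ 2)

/-- The LEVEL TERM of step `k` of the accumulation `ŝ₀ = s`, summands `x`:
`L_k = E[ E(e_k² | ŝ_k) − 2·(ŝ_k − s_k)·y(ŝ_k + x_k) ]`, an expectation over the level-`k` state. -/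
def levelQ (F : Finset K) (q : K → K) (x : ℕ → K) (k : ℕ) (s : K) : K :=
  accExpQ F q x k
    (fun t => sqStepQ F q (t + x k) - 2 * (t - (s + ∑ i ∈ range k, x i)) * truncQ F q (t + x k)) s

omit [IsStrictOrderedRing K] [FloorRing K] in
/-- Variance + squared truncation: `E(round c − c)² = π(1−π)(⌈c̄⌉ − ⌊c̄⌋)² + y(c)²` (`π = pUpQ`). -/
theorem sqStepQ_eq (F : Finset K) (q : K → K) (c : K) :
    sqStepQ F q c = pUpQ F q c * (1 - pUpQ F q c) * (up F c - dn F c) ^ 2 + truncQ F q c ^ 2 := by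
  unfold sqStepQ truncQ stepQ; ring

omit [IsStrictOrderedRing K] [FloorRing K] in
/-- Recentring one step: `E(round c − c + R)² = E(round c − c)² − 2R·y(c) + R²`. -/
theorem stepQ_sq_shift (F : Finset K) (q : K → K) (c R : K) :
    stepQ F q c (fun z => (z - c + R) ^ 2) = sqStepQ F q c - 2 * R * truncQ F q c + R ^ 2 := by
  unfold sqStepQ truncQ stepQ; ring

/-! ### 2. The level decomposition (an identity, no hypotheses) -/

omit [IsStrictOrderedRing K] [FloorRing K] in
/-- **One more step adds its level term**: `E(ŝₙ₊₁ − sₙ₊₁)² = E(ŝₙ − sₙ)² + Lₙ`. -/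
theorem acc_sq_succ_level (F : Finset K) (q : K → K) (x : ℕ → K) (n : ℕ) (s : K) :
    accExpQ F q x (n + 1) (fun t => (t - (s + ∑ i ∈ range (n + 1), x i)) ^ 2) s
      = accExpQ F q x n (fun t => (t - (s + ∑ i ∈ range n, x i)) ^ 2) s + levelQ F q x n s := by
  rw [accExpQ_succ_last]
  have h : (fun a => stepQ F q (a + x n) (fun t => (t - (s + ∑ i ∈ range (n + 1), x i)) ^ 2))
      = fun a => 1 * (a - (s + ∑ i ∈ range n, x i)) ^ 2
          + 1 * (sqStepQ F q (a + x n) - 2 * (a - (s + ∑ i ∈ range n, x i)) * truncQ F q (a + x n)) := by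
    funext a
    have e : (fun t : K => (t - (s + ∑ i ∈ range (n + 1), x i)) ^ 2)
        = fun t => (t - (a + x n) + (a - (s + ∑ i ∈ range n, x i))) ^ 2 := by
      funext t; rw [sum_range_succ]; ring
    rw [e, stepQ_sq_shift]; ring
  rw [h, accExpQ_lin]
  unfold levelQ; ring

omit [IsStrictOrderedRing K] [FloorRing K] in
/-- **THE LEVEL DECOMPOSITION**: `E(ŝₙ − sₙ)² = Σ_{k<n} L_k` for every value set, rule and data. -/
theorem acc_sq_eq_sum_levelQ (F : Finset K) (q : K → K) (x : ℕ → K) (s : K) :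
    ∀ n : ℕ, accExpQ F q x n (fun t => (t - (s + ∑ i ∈ range n, x i)) ^ 2) s
      = ∑ k ∈ range n, levelQ F q x k s
  | 0 => by simp [accExpQ]
  | n + 1 => by rw [acc_sq_succ_level, acc_sq_eq_sum_levelQ F q x s n, sum_range_succ]

omit [IsStrictOrderedRing K] [FloorRing K] in
/-- The mean, level by level: `E[ŝₙ₊₁] − sₙ₊₁ = (E[ŝₙ] − sₙ) − E[y(ŝₙ + xₙ)]`. -/
theorem acc_id_succ_level (F : Finset K) (q : K → K) (x : ℕ → K) (n : ℕ) (s : K) :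
    accExpQ F q x (n + 1) (fun t => t) s - (s + ∑ i ∈ range (n + 1), x i)
      = (accExpQ F q x n (fun t => t) s - (s + ∑ i ∈ range n, x i))
        - accExpQ F q x n (fun t => truncQ F q (t + x n)) s := by
  rw [accExpQ_succ_last]
  have h : (fun a => stepQ F q (a + x n) (fun t => t))
      = fun a => 1 * a + (-1) * (truncQ F q (a + x n) - x n) := by
    funext a; unfold truncQ; ring
  have h2 : (fun a => truncQ F q (a + x n) - x n)
      = fun a => 1 * truncQ F q (a + x n) + (-(x n)) * 1 := by
    funext a; ring
  rw [h, accExpQ_lin, h2, accExpQ_lin, accExpQ_one, sum_range_succ]; ring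

/-! ### 3. The level-budget certificate -/

/-- `LevelLE F q G ε x n s`: every level term is within the Pythagorean per-step budget,
`L_k ≤ G²/4 + (2k+1)(εG)²` for `k < n`. -/
def LevelLE (F : Finset K) (q : K → K) (G ε : K) (x : ℕ → K) (n : ℕ) (s : K) : Prop :=
  ∀ k < n, levelQ F q x k s ≤ G ^ 2 / 4 + (2 * k + 1) * (ε * G) ^ 2

/-- Boolean evaluator of `LevelLE` (kernel decision of instances). -/
def levelLEB (F : Finset K) (q : K → K) (G ε : K) (x : ℕ → K) (n : ℕ) (s : K) : Bool :=
  (List.range n).all fun k => decide (levelQ F q x k s ≤ G ^ 2 / 4 + (2 * k + 1) * (ε * G) ^ 2)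

omit [IsStrictOrderedRing K] [FloorRing K] in
/-- `levelLEB` decides `LevelLE`. -/
theorem levelLEB_iff (F : Finset K) (q : K → K) (G ε : K) (x : ℕ → K) (n : ℕ) (s : K) :
    levelLEB F q G ε x n s = true ↔ LevelLE F q G ε x n s := by
  unfold levelLEB LevelLE
  simp [List.all_eq_true, List.mem_range]

omit [FloorRing K] in
/-- **LEVEL-BUDGET CERTIFICATE**: `LevelLE ⟹ E(ŝₙ − sₙ)² ≤ n·G²/4 + (n·εG)²` (any `F`, `q`, data;
`Σ_{k<n} (2k+1) = n²`). -/
theorem acc_sq_le_of_levelLE (F : Finset K) (q : K → K) (G ε : K) (x : ℕ → K) (s : K) :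
    ∀ n : ℕ, LevelLE F q G ε x n s →
      accExpQ F q x n (fun t => (t - (s + ∑ i ∈ range n, x i)) ^ 2) s ≤ n * (G ^ 2 / 4) + (n * (ε * G)) ^ 2
  | 0, _ => by simp [accExpQ]
  | n + 1, h => by
      rw [acc_sq_succ_level]
      have h1 := acc_sq_le_of_levelLE F q G ε x s n (fun k hk => h k (Nat.lt_succ_of_lt hk))
      have h2 := h n (Nat.lt_succ_self n)
      push_cast
      nlinarith [h1, h2]

/-! ### 4. Deterministic truncation schedules obey the law -/

/-- `TruncSched F q η x n s`: along EVERY branch of the `n`-step tree from `s`, the mean truncation of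
step `k` equals `η k` (a deterministic truncation schedule). -/
def TruncSched (F : Finset K) (q : K → K) : (ℕ → K) → (ℕ → K) → ℕ → K → Prop
  | _, _, 0, _ => True
  | η, x, n + 1, s => truncQ F q (s + x 0) = η 0 ∧
      TruncSched F q (fun i => η (i + 1)) (fun i => x (i + 1)) n (up F (s + x 0)) ∧
      TruncSched F q (fun i => η (i + 1)) (fun i => x (i + 1)) n (dn F (s + x 0))

/-- Boolean evaluator of `TruncSched`. -/
def truncSchedB (F : Finset K) (q : K → K) : (ℕ → K) → (ℕ → K) → ℕ → K → Bool
  | _, _, 0, _ => true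
  | η, x, n + 1, s => decide (truncQ F q (s + x 0) = η 0) &&
      truncSchedB F q (fun i => η (i + 1)) (fun i => x (i + 1)) n (up F (s + x 0)) &&
      truncSchedB F q (fun i => η (i + 1)) (fun i => x (i + 1)) n (dn F (s + x 0))

omit [IsStrictOrderedRing K] [FloorRing K] in
/-- `truncSchedB` decides `TruncSched`. -/
theorem truncSchedB_iff (F : Finset K) (q : K → K) :
    ∀ (η : ℕ → K) (x : ℕ → K) (n : ℕ) (s : K), truncSchedB F q η x n s = true ↔ TruncSched F q η x n s
  | η, x, 0, s => by simp [truncSchedB, TruncSched]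
  | η, x, n + 1, s => by
      simp only [truncSchedB, TruncSched, Bool.and_eq_true, decide_eq_true_eq]
      rw [truncSchedB_iff F q _ _ n, truncSchedB_iff F q _ _ n, and_assoc]

/-- **DETERMINISTIC TRUNCATION ⇒ PYTHAGOREAN LAW** (any value set, any rule `q : [0,1] → [0,1]`, any
data).  If no branch saturates, every candidate gap is `≤ G` and the truncation schedule is the
deterministic `η`, then `E[ŝₙ] = sₙ − Σ_{k<n} η_k` exactly and
`E(ŝₙ − sₙ)² ≤ n·G²/4 + (Σ_{k<n} η_k)²` (law of total variance with deterministic conditional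
means: the martingale part has per-step variance `π(1−π)w² ≤ G²/4`). -/
theorem acc_sq_le_of_truncSched (F : Finset K) {q : K → K} {G : K}
    (hq01 : ∀ θ, 0 ≤ θ → θ ≤ 1 → 0 ≤ q θ ∧ q θ ≤ 1) :
    ∀ (x : ℕ → K) (n : ℕ) (η : ℕ → K) (s : K), NoSat F x n s → GapLE F G x n s →
      TruncSched F q η x n s →
      accExpQ F q x n (fun t => t) s = s + ∑ i ∈ range n, x i - ∑ k ∈ range n, η k ∧
      accExpQ F q x n (fun t => (t - (s + ∑ i ∈ range n, x i)) ^ 2) s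
        ≤ n * (G ^ 2 / 4) + (∑ k ∈ range n, η k) ^ 2 := by
  intro x n
  induction n generalizing x with
  | zero => intro η s _ _ _; simp [accExpQ]
  | succ n ih =>
    rintro η s ⟨-, hnu, hnd⟩ ⟨hgap, hgu, hgd⟩ ⟨hη, hsu, hsd⟩
    have hw : up F (s + x 0) - dn F (s + x 0) ≤ G := hgap
    have hw0 : 0 ≤ up F (s + x 0) - dn F (s + x 0) := sub_nonneg.mpr (dn_le_up F _)
    obtain ⟨hp0, hp1⟩ := pUpQ_mem F hq01 (s + x 0)
    obtain ⟨IHu1, IHu2⟩ := ih (fun i => x (i + 1)) (fun i => η (i + 1)) (up F (s + x 0)) hnu hgu hsu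
    obtain ⟨IHd1, IHd2⟩ := ih (fun i => x (i + 1)) (fun i => η (i + 1)) (dn F (s + x 0)) hnd hgd hsd
    have hy : s + x 0 - (pUpQ F q (s + x 0) * up F (s + x 0) + (1 - pUpQ F q (s + x 0)) * dn F (s + x 0))
        = η 0 := by
      have h := hη; unfold truncQ stepQ at h; exact h
    set p := pUpQ F q (s + x 0) with hp
    set u := up F (s + x 0) with hu
    set d := dn F (s + x 0) with hd
    set S := ∑ i ∈ range n, x (i + 1) with hS
    set H := ∑ k ∈ range n, η (k + 1) with hH
    constructor
    · show stepQ F q (s + x 0) (accExpQ F q (fun i => x (i + 1)) n (fun t => t)) = _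
      unfold stepQ
      rw [← hp, ← hu, ← hd, IHu1, IHd1, sum_range_succ' x, sum_range_succ' η]
      linear_combination (-1 : K) * hy
    · have e : (fun t : K => (t - (s + ∑ i ∈ range (n + 1), x i)) ^ 2)
          = fun t => (t - ((s + x 0) + S)) ^ 2 := by
        funext t; rw [sum_range_succ']; ring
      rw [e]
      show stepQ F q (s + x 0) (accExpQ F q (fun i => x (i + 1)) n (fun t => (t - ((s + x 0) + S)) ^ 2))
        ≤ _
      unfold stepQ
      rw [← hp, ← hu, ← hd, accExpQ_sq_split F q _ n u S (s + x 0),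
        accExpQ_sq_split F q _ n d S (s + x 0), IHu1, IHd1, sum_range_succ' η]
      have hpq : p * (1 - p) ≤ 1 / 4 := by nlinarith [sq_nonneg (p - 1 / 2)]
      have hG2 : (u - d) ^ 2 ≤ G ^ 2 := pow_le_pow_left₀ hw0 hw 2
      have hv : p * (1 - p) * (u - d) ^ 2 ≤ G ^ 2 / 4 := by
        nlinarith [mul_le_mul_of_nonneg_right hpq (sq_nonneg (u - d)),
          mul_le_mul_of_nonneg_left hG2 (by norm_num : (0 : K) ≤ 1 / 4)]
      have h3 : H * (s + x 0 - (p * u + (1 - p) * d)) = H * η 0 := by rw [hy]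
      have h4 : (s + x 0 - (p * u + (1 - p) * d)) ^ 2 = η 0 ^ 2 := by rw [hy]
      have hu2 := mul_le_mul_of_nonneg_left IHu2 hp0
      have hd2 := mul_le_mul_of_nonneg_left IHd2 (sub_nonneg.mpr hp1)
      push_cast
      linarith [hu2, hd2, hv, h3, h4]

/-- With a rule `ε`-close to the identity every mean truncation is `≤ εG` in size, so a deterministic
schedule gives `E(ŝₙ − sₙ)² ≤ n·G²/4 + (n·εG)²`. -/
theorem acc_sq_le_of_truncSched_eps (F : Finset K) {q : K → K} {G ε : K}
    (hq01 : ∀ θ, 0 ≤ θ → θ ≤ 1 → 0 ≤ q θ ∧ q θ ≤ 1) (hq : ∀ θ, 0 ≤ θ → θ ≤ 1 → |q θ - θ| ≤ ε)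
    (hε : 0 ≤ ε) :
    ∀ (x : ℕ → K) (n : ℕ) (η : ℕ → K) (s : K), NoSat F x n s → GapLE F G x n s →
      TruncSched F q η x n s →
      accExpQ F q x n (fun t => (t - (s + ∑ i ∈ range n, x i)) ^ 2) s
        ≤ n * (G ^ 2 / 4) + (n * (ε * G)) ^ 2 := by
  -- every scheduled truncation met on the tree is `≤ εG` in absolute value
  have hbound : ∀ (x : ℕ → K) (n : ℕ) (η : ℕ → K) (s : K), NoSat F x n s → GapLE F G x n s →
      TruncSched F q η x n s → |∑ k ∈ range n, η k| ≤ n * (ε * G) := by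
    intro x n
    induction n generalizing x with
    | zero => intro η s _ _ _; simp
    | succ n ih =>
      rintro η s ⟨hin, hnu, -⟩ ⟨hgap, hgu, -⟩ ⟨hη, hsu, -⟩
      have hw : up F (s + x 0) - dn F (s + x 0) ≤ G := hgap
      have h0 : |η 0| ≤ ε * G := by
        have h := abs_stepQ_id_sub_le F hq (s + x 0)
        rw [clamp_eq_self hin] at h
        rw [← hη]; unfold truncQ
        rw [abs_sub_comm]
        exact h.trans (mul_le_mul_of_nonneg_left hw hε)
      have h1 := ih (fun i => x (i + 1)) (fun i => η (i + 1)) (up F (s + x 0)) hnu hgu hsu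
      rw [sum_range_succ']
      push_cast
      calc |∑ k ∈ range n, η (k + 1) + η 0| ≤ |∑ k ∈ range n, η (k + 1)| + |η 0| := abs_add_le _ _
        _ ≤ n * (ε * G) + ε * G := add_le_add h1 h0
        _ = (n + 1) * (ε * G) := by ring
  intro x n η s hns hg hsch
  have h := (acc_sq_le_of_truncSched F hq01 x n η s hns hg hsch).2
  have hb := hbound x n η s hns hg hsch
  have hsq : (∑ k ∈ range n, η k) ^ 2 ≤ (n * (ε * G)) ^ 2 := by
    have := sq_le_sq' (abs_le.mp hb).1 (abs_le.mp hb).2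
    exact this
  linarith

/-- **IEEE P3109 StochasticA, every number `N` of random bits, every window**: a tree with a
deterministic truncation schedule obeys `E(ŝₙ − sₙ)² ≤ n·G²/4 + (n·2^{-N}·G)²`. -/
theorem stochasticA_acc_sq_le_of_truncSched (F : Finset K) (N : ℕ) {G : K} (x : ℕ → K) (n : ℕ)
    (η : ℕ → K) (s : K) (hns : NoSat F x n s) (hg : GapLE F G x n s)
    (hsch : TruncSched F (probAwayA N) η x n s) :
    accExpQ F (probAwayA N) x n (fun t => (t - (s + ∑ i ∈ range n, x i)) ^ 2) s
      ≤ n * (G ^ 2 / 4) + (n * (1 / 2 ^ N * G)) ^ 2 :=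
  acc_sq_le_of_truncSched_eps F (probAwayA_mem N) (fun θ _ _ => abs_probAwayA_sub_le N θ)
    (by positivity) x n η s hns hg hsch

end LimitedBits

/-! ### 5. Kernel instances (E3M2) -/

namespace Formats

open LimitedBits

/-- The six summands of the node-budget-breaking tree of CXV's docstring (both signs). -/
def xNB3 : ℕ → ℚ := seqL [-1921 / 256, -47 / 16, 1671 / 128, 639 / 256, -125 / 8, 4507 / 256]

/-- **The level budget certifies a tree that breaks every 3-bit node budget** (kernel).  E3M2,
StochasticA with `N = 3` random bits, window `[3/8, 28]` (seven spacings `1/16 … 4`, `G = 4`,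
`E = 1/2`), `ŝ₀ = 14`, summands `xNB3`: no saturation, all six level terms within
`G²/4 + (2k+1)E²`, hence `E(ŝ₆ − s₆)² ≤ 6·G²/4 + (6·E)² = 33`; the exact value is `5812069/524288`
(`≈ 11.09`).  (Its second level term is NEGATIVE, `−83/16384`: a fine step refunds budget.) -/
theorem e3m2_xNB3_levelLE_law :
    NoSat e3m2 xNB3 6 14 ∧ InWindow e3m2 (3 / 8) 28 xNB3 6 14 ∧
    LevelLE e3m2 (probAwayA 3) 4 (1 / 2 ^ 3) xNB3 6 14 ∧
    levelQ e3m2 (probAwayA 3) xNB3 1 14 = -83 / 16384 ∧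
    accExpQ e3m2 (probAwayA 3) xNB3 6 (fun t => (t - (14 + ∑ i ∈ range 6, xNB3 i)) ^ 2) 14
      ≤ 6 * ((4 : ℚ) ^ 2 / 4) + (6 * ((1 : ℚ) / 2 ^ 3 * 4)) ^ 2 ∧
    accExpQ e3m2 (probAwayA 3) xNB3 6 (fun t => (t - 5399 / 256) ^ 2) 14 = 5812069 / 524288 := by
  have hL : LevelLE e3m2 (probAwayA 3) 4 (1 / 2 ^ 3) xNB3 6 14 := by
    rw [← levelLEB_iff]; decide +kernel
  refine ⟨by rw [← noSatB_iff]; decide +kernel, by rw [← inWindowB_iff]; decide +kernel, hL,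
    by decide +kernel, acc_sq_le_of_levelLE e3m2 (probAwayA 3) 4 (1 / 2 ^ 3) xNB3 14 6 hL,
    by decide +kernel⟩

/-- **A deterministic schedule in the top binade** (kernel instance of §4).  E3M2, `N = 3`, from
`ŝ₀ = 16` add `39/16` three times (the extremal family `G/2 + E − δ` of CXV with `δ = 1/16`, inside the
equally spaced binade `[16, 28]`, `G = 4`): every step truncates by exactly `η = 7/16` on every branch,
so `E(ŝ₃ − s₃)² ≤ 3·G²/4 + (3·7/16)² = 12 + 441/256`; the exact value is `12 + 441/256` — the bound
of `acc_sq_le_of_truncSched` is ATTAINED (three fair coins of variance `G²/4` each). -/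
theorem e3m2_top_binade_truncSched :
    TruncSched e3m2 (probAwayA 3) (fun _ => 7 / 16) (fun _ => 39 / 16) 3 16 ∧
    NoSat e3m2 (fun _ => (39 : ℚ) / 16) 3 16 ∧ GapLE e3m2 4 (fun _ => (39 : ℚ) / 16) 3 16 ∧
    accExpQ e3m2 (probAwayA 3) (fun _ => (39 : ℚ) / 16) 3
        (fun t => (t - (16 + ∑ i ∈ range 3, (fun _ => (39 : ℚ) / 16) i)) ^ 2) 16
      ≤ 3 * ((4 : ℚ) ^ 2 / 4) + (∑ k ∈ range 3, (fun _ => (7 : ℚ) / 16) k) ^ 2 ∧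
    accExpQ e3m2 (probAwayA 3) (fun _ => (39 : ℚ) / 16) 3 (fun t => (t - 373 / 16) ^ 2) 16
      = 3 * ((4 : ℚ) ^ 2 / 4) + (3 * (7 / 16)) ^ 2 := by
  have hsch : TruncSched e3m2 (probAwayA 3) (fun _ => 7 / 16) (fun _ => 39 / 16) 3 16 := by
    rw [← truncSchedB_iff]; decide +kernel
  have hns : NoSat e3m2 (fun _ => (39 : ℚ) / 16) 3 16 := by rw [← noSatB_iff]; decide +kernel
  have hg : GapLE e3m2 4 (fun _ => (39 : ℚ) / 16) 3 16 := by rw [← gapLEB_iff]; decide +kernel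
  exact ⟨hsch, hns, hg, (acc_sq_le_of_truncSched e3m2 (probAwayA_mem 3) _ 3 _ 16 hns hg hsch).2,
    by decide +kernel⟩

end Formats

end Summit.Ventures.CertifiedArithmetic.LowPrec.SR
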